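import Summits.AtomisticToContinuum.HydrodynamicLimit.Theorems.AntiMazurCoboundariesCellForecastPressureDecayObjects
import HarnessLib

/-!
# Stub `stub_labelCumulantDifferentiable` of the crux line `tilt-analyticity-transfer`
(crux `AntiMazurCoboundaries.CellForecastPressureDecay`, stmt-AtomisticToContinuum-13915)

Helper file of the line (`--supports stmt-AtomisticToContinuum-13915`); objects imported from
`Theorems/AntiMazurCoboundariesCellForecastPressureDecayObjects.lean` (namespace `…Theorems.TiltAnalyticity`, p80905).
-/

noncomputable section

open MeasureTheory Set Metric Filter ProbabilityTheory Topology
open scoped ENNReal BigOperators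
open Literature.Analysis.FluidPDE Literature.MathematicalPhysics.KineticTheory
open Literature.Probability.LatticeModels (polymerPartitionFunction)

namespace Summit.AtomisticToContinuum.HydrodynamicLimit.Theorems.TiltAnalyticity

/-! ## Stub S2b: the label cumulants are entire in the tilt

For bounded measurable real `w_j` the moments `m_d(c) = E ∏_{j∈d} (e^{2c w_j} − 1)` expand, by
`∏ (f − 1) = Σ_{t ⊆ d} (−1)^{#t} ∏_{d∖t} f` (`Finset.prod_sub`), into a finite signed sum of complex
moment generating functions `M_s(2c) = E e^{2c Σ_{i∈s} w_i}` (`ProbabilityTheory.complexMGF`) of the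
bounded partial sums `Σ_{i∈s} w_i`; these are entire (`hasDerivAt_complexMGF`, the domain
`integrableExpSet` being all of `ℝ` for a bounded variable on a finite measure space). The
anchored recursion `κ(B) = m(B) − Σ_{A ⊂ B, min B ∈ A} κ(A) m(B ∖ A)` (`cumulantOfMoments_eq`)
then makes every cumulant a polynomial in moments and lower cumulants, entire by strong
induction on `B`. -/

section LabelCumulantDifferentiable

/-- Finite sums of reals bounded by `A` are bounded: `|Σ_{i∈s} x_i| ≤ #s · A`. -/
private theorem abs_sum_le_card_mul {ι : Type*} {x : ι → ℝ} {A : ℝ} (hb : ∀ j, |x j| ≤ A)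
    (s : Finset ι) : |∑ i ∈ s, x i| ≤ s.card * A :=
  calc |∑ i ∈ s, x i| ≤ ∑ i ∈ s, |x i| := Finset.abs_sum_le_sum_abs _ _
    _ ≤ ∑ _i ∈ s, A := Finset.sum_le_sum fun i _ => hb i
    _ = s.card * A := by rw [Finset.sum_const, nsmul_eq_mul]

variable {Ω : Type*} [MeasurableSpace Ω]

/-- For a bounded measurable real variable on a finite measure space, `e^{tX}` is integrable for
every real `t`: `integrableExpSet X P = univ`. -/
private theorem integrableExpSet_eq_univ_of_abs_le (P : Measure Ω) [IsFiniteMeasure P]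
    {X : Ω → ℝ} {C : ℝ} (hX : Measurable X) (hb : ∀ ω, |X ω| ≤ C) :
    integrableExpSet X P = Set.univ := by
  refine Set.eq_univ_of_forall fun t => ?_
  change Integrable (fun ω => Real.exp (t * X ω)) P
  refine Integrable.of_bound (hX.const_mul t).exp.aestronglyMeasurable (Real.exp (|t| * C))
    (Eventually.of_forall fun ω => ?_)
  rw [Real.norm_eq_abs, Real.abs_exp, Real.exp_le_exp]
  calc t * X ω ≤ |t * X ω| := le_abs_self _
    _ = |t| * |X ω| := abs_mul _ _
    _ ≤ |t| * C := mul_le_mul_of_nonneg_left (hb ω) (abs_nonneg t)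

/-- The complex moment generating function of a bounded measurable real variable on a finite
measure space is entire. -/
private theorem differentiable_complexMGF_of_abs_le (P : Measure Ω) [IsFiniteMeasure P]
    {X : Ω → ℝ} {C : ℝ} (hX : Measurable X) (hb : ∀ ω, |X ω| ≤ C) :
    Differentiable ℂ (complexMGF X P) := fun z =>
  (hasDerivAt_complexMGF (z := z) (by
    rw [integrableExpSet_eq_univ_of_abs_le P hX hb, interior_univ]; trivial)).differentiableAt

/-- Integrability of `e^{zX}` for a bounded measurable real `X` on a finite measure space and
complex `z`. -/
private theorem integrable_cexp_mul_of_abs_le (P : Measure Ω) [IsFiniteMeasure P]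
    {X : Ω → ℝ} {C : ℝ} (hX : Measurable X) (hb : ∀ ω, |X ω| ≤ C) (z : ℂ) :
    Integrable (fun ω => Complex.exp (z * X ω)) P :=
  integrable_cexp_mul_of_re_mem_integrableExpSet hX.aemeasurable
    (by rw [integrableExpSet_eq_univ_of_abs_le P hX hb]; trivial)

variable {n : ℕ}

/-- **Inclusion–exclusion expansion of the label moments**: for every index set `d`,
`E ∏_{j∈d} (e^{2c w_j} − 1) = Σ_{t ⊆ d} (−1)^{#t} · M_{d∖t}(2c)`, with `M_s` the complex moment
generating function of the partial sum `Σ_{i∈s} w_i`. -/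
theorem momentOf_labelVar_eq (P : Measure Ω) [IsFiniteMeasure P] {w : Fin n → Ω → ℝ} {A : ℝ}
    (hw : ∀ j, Measurable (w j)) (hb : ∀ j ω, |w j ω| ≤ A) (c : ℂ) (d : Finset (Fin n)) :
    momentOf P (labelVar w c) d = ∑ t ∈ d.powerset,
      (-1) ^ t.card * complexMGF (fun ω => ∑ i ∈ d \ t, w i ω) P (2 * c) := by
  have h1 : ∀ ω, ∏ j ∈ d, labelVar w c j ω = ∑ t ∈ d.powerset,
      (-1) ^ t.card * Complex.exp (2 * c * ((∑ i ∈ d \ t, w i ω : ℝ) : ℂ)) := by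
    intro ω
    simp only [labelVar]
    rw [Finset.prod_sub]
    refine Finset.sum_congr rfl fun t _ => ?_
    rw [Finset.prod_const_one, mul_one, Complex.ofReal_sum, Finset.mul_sum, Complex.exp_sum]
  simp only [momentOf, h1, complexMGF]
  rw [integral_finsetSum]
  · exact Finset.sum_congr rfl fun t _ => integral_const_mul _ _
  · intro t _
    exact (integrable_cexp_mul_of_abs_le P (Finset.measurable_sum _ fun i _ => hw i)
      (fun ω => abs_sum_le_card_mul (fun j => hb j ω) (d \ t)) (2 * c)).const_mul _

/-- **The label moments are entire** in the tilt. -/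
theorem differentiable_momentOf_labelVar (P : Measure Ω) [IsFiniteMeasure P]
    {w : Fin n → Ω → ℝ} {A : ℝ} (hw : ∀ j, Measurable (w j)) (hb : ∀ j ω, |w j ω| ≤ A)
    (d : Finset (Fin n)) : Differentiable ℂ fun c : ℂ => momentOf P (labelVar w c) d := by
  have h : (fun c : ℂ => momentOf P (labelVar w c) d) = fun c => ∑ t ∈ d.powerset,
      (-1) ^ t.card * complexMGF (fun ω => ∑ i ∈ d \ t, w i ω) P (2 * c) :=
    funext fun c => momentOf_labelVar_eq P hw hb c d
  rw [h]
  refine Differentiable.fun_sum fun t _ => Differentiable.const_mul ?_ _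
  exact (differentiable_complexMGF_of_abs_le P (Finset.measurable_sum _ fun i _ => hw i)
    (fun ω => abs_sum_le_card_mul (fun j => hb j ω) (d \ t))).comp
    (differentiable_id.const_mul (2 : ℂ))

/-- **The label cumulants are entire** in the tilt: strong induction on `B` along the anchored
moment–cumulant recursion `cumulantOfMoments_eq`. -/
theorem differentiable_jointCumulant_labelVar (P : Measure Ω) [IsFiniteMeasure P]
    {w : Fin n → Ω → ℝ} {A : ℝ} (hw : ∀ j, Measurable (w j)) (hb : ∀ j ω, |w j ω| ≤ A)
    (B : Finset (Fin n)) : Differentiable ℂ fun c : ℂ => jointCumulant P (labelVar w c) B := by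
  induction B using Finset.strongInduction with
  | H B ih =>
    by_cases hB : B.Nonempty
    · have h : (fun c : ℂ => jointCumulant P (labelVar w c) B) = fun c =>
          momentOf P (labelVar w c) B -
            ∑ A' ∈ B.powerset.filter (fun A' => A' ⊂ B ∧ B.min' hB ∈ A'),
              jointCumulant P (labelVar w c) A' * momentOf P (labelVar w c) (B \ A') :=
        funext fun c => cumulantOfMoments_eq (momentOf P (labelVar w c)) hB
      rw [h]
      refine (differentiable_momentOf_labelVar P hw hb B).fun_sub
        (Differentiable.fun_sum fun A' hA' => ?_)
      exact (ih A' (Finset.mem_filter.1 hA').2.1).fun_mul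
        (differentiable_momentOf_labelVar P hw hb _)
    · have h : (fun c : ℂ => jointCumulant P (labelVar w c) B) = fun _ => (0 : ℂ) :=
        funext fun c => cumulantOfMoments_of_not_nonempty _ hB
      rw [h]
      exact differentiable_const 0

end LabelCumulantDifferentiable

/-- **Registered stub S2b `stub_labelCumulantDifferentiable`** (line `tilt-analyticity-transfer`, crux
stmt-AtomisticToContinuum-13915): the joint cumulants of the label variables `e^{2c w_j} − 1` of bounded
measurable real `w_j` are entire functions of the tilt `c`. [folklore] -/
theorem stub_labelCumulantDifferentiable :
    ∀ (Ω : Type) [MeasurableSpace Ω] (P : Measure Ω) [IsProbabilityMeasure P] (n : ℕ)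
      (w : Fin n → Ω → ℝ) (A : ℝ), (∀ j, Measurable (w j)) → (∀ j ω, |w j ω| ≤ A) →
      ∀ B : Finset (Fin n), Differentiable ℂ (fun c : ℂ => jointCumulant P (labelVar w c) B) :=
  fun _ _ P _ _ _ _ hw hb B => differentiable_jointCumulant_labelVar P hw hb B

end Summit.AtomisticToContinuum.HydrodynamicLimit.Theorems.TiltAnalyticity

end
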